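/-
Copyright (c) 2026 the pub-hodgecm-mathlib formalisation cell (harness21).  Prover seat hodgecm-mathlib-K2Liu-p09 (g0): Track B «K2-LIT»,
#184♮ = hLiu418 = stmt-HodgeConjecture-24832, file #9 of the K2_Liu road (socket module
`Cruxes/HLiu418/Lines/K2_Liu_CurveThetaSigs_U3a_SiegelEisenstein.lean` feca6d8e9697719e), organ (III-b) step (a); 2026-09-03.
-/
import Literature.NumberTheory.K2Lit.SiegelEisensteinSeriesDoubled                      -- ★ `modDelta_pos` (and ★ GRConstruction `HA`, `modDelta`)
import HarnessLib

/-!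
# Crux `HLiu418`, Track B road `K2_Liu`, unit U3a «SIEGEL EISENSTEIN SERIES», file #9 — helper 4 (organ (III-b), step (a) «SMEAR»):
# a height of type `(P_Δ, modDelta)` is comparable to its right translates by a compact set, uniformly on `H(𝔸)`

Cell `hodgecm-mathlib`, crux item hLiu418 = `stmt-HodgeConjecture-24832`, route of record `HCCMUnconditional`; squad K2 ∕ K2Liu,
prover K2Liu-p09 (g0).  THEOREMS ONLY (no `def`, no instance, no notation, no named-fact hypothesis, no `sorry`); lane
`--supports stmt-HodgeConjecture-24832` (count-neutral helper toward socket #9 `sig_K2LiuSiegelEisensteinDoubledSummable`).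

This is step (a) of Godement's count ([Garrett2018, §3.10, proof of Cor. 3.10.2]: «from reduction theory, given compact `C`,
`h(v) ≪_C h(v·g) ≪_C h(v)` … therefore convergence of the series … is equivalent to convergence of `∫_C Σ_γ φ(γ g) dg`»), in the
abstract form in which the tree's height enters: for the doubled group `H(𝔸) = U(𝕍 ⊕ −𝕍)(𝔸)` (★ `GRConstruction.HA`) with an
Iwasawa decomposition `H(𝔸) = P_Δ(𝔸) · K₀`, `K₀` compact (★ `K2LiuSiegelDoubledIwasawaCompact.exists_isCompact_isSiegelDelta_mul`),
and ANY `Φ : H(𝔸) → ℝ` with `Φ > 0`, `Φ(p x) = modDelta(p) Φ(x)` on `P_Δ(𝔸)`, bounded above and below by positive constants on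
compacta (all supplied by ★ `K2LiuSiegelDoubledPluckerHeight.exists_siegelHeight`, the upper bound being its FLOOR (4) at `γ = 1`):

* `apply_mul_eq_of_decomp` — `Φ(x c) = modDelta(p) · Φ(k c)` for `x = p k`;
* **`exists_smear_const`** — for every compact `C` there is `A ≥ 1` with `Φ(x c) ≤ A Φ(x)` and `Φ(x) ≤ A Φ(x c)` for ALL `x ∈ H(𝔸)`,
  `c ∈ C` (`x = p k`, `Φ(x c)/Φ(x) = Φ(k c)/Φ(k)` with `k ∈ K₀`, `k c ∈ K₀ C` compact);
* `rpow_apply_mul_le` — hence `Φ(x)^τ ≤ A^τ Φ(x c)^τ` for `τ ≥ 0` (the form used to dominate the series by its `C`-average).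

HONEST LABEL.  Count-neutral helper of the K2_Liu road; it retires nothing by itself: `HC_CM` is proved only modulo the 7 printed
citations (2 remaining named inputs: hLiu418 = `stmt-HodgeConjecture-24832`, h413 = `stmt-HodgeConjecture-24833`) until rung 0 closes.

## References
* [Garrett2018] P. Garrett, *Modern Analysis of Automorphic Forms by Example* (2018), §3.10 (proof of Cor. 3.10.2), Thm. 2.2.2.
* [MoeglinWaldspurger1995] C. Mœglin, J.-L. Waldspurger, *Spectral Decomposition and Eisenstein Series* (1995), II.1.5; I.2.2.
* [Liu2021] Y. Liu, Camb. J. Math. 9 (2021), App. B §B.3 p. 101, Lem. B.10 (2).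
-/

set_option autoImplicit false
-- the mandated namespace repeats the single-problem summit's segment (`HodgeConjecture.HodgeConjecture`)
set_option linter.dupNamespace false

noncomputable section

open scoped Matrix Pointwise
open NumberField IsDedekindDomain

namespace Summit.HodgeConjecture.HodgeConjecture.Cruxes.HLiu418.K2LiuSiegelDoubledHeightSmear

open Literature.NumberTheory.Automorphic
open Literature.NumberTheory.GelbartRogawski1991 Literature.NumberTheory.GelbartRogawski1991.GRConstruction
open Literature.NumberTheory.K2Lit.SiegelDoubled

variable (L : Type) [Field L] [NumberField L] [IsCMField L]
variable {N M n : ℕ} (e : Fin N × Fin M ≃ Fin n)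
  (dV : Fin N → L) (hdV : ∀ i, IsCMField.complexConj L (dV i) = dV i)
  (dW : Fin M → L) (hdW : ∀ i, IsCMField.complexConj L (dW i) = dW i)

/-- `Φ(p k c) = modDelta(p) · Φ(k c)`: right translation commutes with the `P_Δ`-equivariance. [cite: Garrett2018, §3.10] -/
theorem apply_mul_eq_of_decomp {Φ : HA L e dV hdV dW hdW → ℝ}
    (hΦ : ∀ p x : HA L e dV hdV dW hdW, IsSiegelDelta L e dV hdV dW hdW p → Φ (p * x) = modDelta L e dV hdV dW hdW p * Φ x)
    {x p k : HA L e dV hdV dW hdW} (hp : IsSiegelDelta L e dV hdV dW hdW p) (hx : x = p * k) (c : HA L e dV hdV dW hdW) :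
    Φ (x * c) = modDelta L e dV hdV dW hdW p * Φ (k * c) := by
  rw [hx, mul_assoc, hΦ p (k * c) hp]

omit [NumberField L] [IsCMField L] in
/-- A positive function bounded above and below by positive constants on two compacta has bounded ratios across them. [folklore] -/
theorem exists_ratio_bound {X : Type*} {Φ : X → ℝ} {K₁ K₂ : Set X} {c₁ C₂ : ℝ} (hc₁ : 0 < c₁)
    (h₁ : ∀ k ∈ K₁, c₁ ≤ Φ k) (h₂ : ∀ k ∈ K₂, Φ k ≤ C₂) :
    ∀ k₁ ∈ K₁, ∀ k₂ ∈ K₂, Φ k₂ ≤ max (C₂ / c₁) 1 * Φ k₁ := by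
  intro k₁ hk₁ k₂ hk₂
  have hΦ1 : c₁ ≤ Φ k₁ := h₁ k₁ hk₁
  have hΦ1pos : 0 < Φ k₁ := lt_of_lt_of_le hc₁ hΦ1
  calc Φ k₂ ≤ C₂ := h₂ k₂ hk₂
    _ = C₂ / c₁ * c₁ := by rw [div_mul_cancel₀ _ hc₁.ne']
    _ ≤ max (C₂ / c₁) 1 * c₁ := mul_le_mul_of_nonneg_right (le_max_left _ _) hc₁.le
    _ ≤ max (C₂ / c₁) 1 * Φ k₁ := mul_le_mul_of_nonneg_left hΦ1 (le_trans zero_le_one (le_max_right _ _))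

/-- **SMEAR (Godement ∕ Garrett, step (a)).**  Let `H(𝔸) = P_Δ(𝔸) · K₀` with `K₀` compact, and let `Φ > 0` be a height of type
`(P_Δ, modDelta)` bounded above and below by positive constants on every compact set.  Then for every compact `C ⊆ H(𝔸)` there is
`A ≥ 1` with `Φ(x c) ≤ A · Φ(x)` and `Φ(x) ≤ A · Φ(x c)` for ALL `x ∈ H(𝔸)` and `c ∈ C`: writing `x = p k`, `k ∈ K₀`,
`Φ(x c) ∕ Φ(x) = Φ(k c) ∕ Φ(k)` with `k c` in the compact `K₀ · C`. [cite: Garrett2018, §3.10 (proof of Cor. 3.10.2)]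
[cite: MoeglinWaldspurger1995, I.2.2] -/
theorem exists_smear_const {K₀ : Set (HA L e dV hdV dW hdW)} (hK₀ : IsCompact K₀)
    (hPK : ∀ x : HA L e dV hdV dW hdW, ∃ p k : HA L e dV hdV dW hdW, IsSiegelDelta L e dV hdV dW hdW p ∧ k ∈ K₀ ∧ x = p * k)
    {Φ : HA L e dV hdV dW hdW → ℝ} (hΦpos : ∀ x, 0 < Φ x)
    (hΦ : ∀ p x : HA L e dV hdV dW hdW, IsSiegelDelta L e dV hdV dW hdW p → Φ (p * x) = modDelta L e dV hdV dW hdW p * Φ x)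
    (hΦlow : ∀ K : Set (HA L e dV hdV dW hdW), IsCompact K → ∃ c : ℝ, 0 < c ∧ ∀ k ∈ K, c ≤ Φ k)
    (hΦup : ∀ K : Set (HA L e dV hdV dW hdW), IsCompact K → ∃ C : ℝ, ∀ k ∈ K, Φ k ≤ C)
    {C : Set (HA L e dV hdV dW hdW)} (hC : IsCompact C) :
    ∃ A : ℝ, 1 ≤ A ∧ ∀ x : HA L e dV hdV dW hdW, ∀ c ∈ C, Φ (x * c) ≤ A * Φ x ∧ Φ x ≤ A * Φ (x * c) := by
  -- the compact `K₀ · C`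
  have hK₁ : IsCompact (K₀ * C) := hK₀.mul hC
  obtain ⟨c₀, hc₀, hlow₀⟩ := hΦlow K₀ hK₀
  obtain ⟨c₁, hc₁, hlow₁⟩ := hΦlow (K₀ * C) hK₁
  obtain ⟨C₀, hup₀⟩ := hΦup K₀ hK₀
  obtain ⟨C₁, hup₁⟩ := hΦup (K₀ * C) hK₁
  refine ⟨max (max (C₁ / c₀) 1) (max (C₀ / c₁) 1), le_trans (le_max_right _ _) (le_max_left _ _), fun x c hc => ?_⟩
  obtain ⟨p, k, hp, hk, hx⟩ := hPK x
  have hkc : k * c ∈ K₀ * C := Set.mul_mem_mul hk hc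
  have hmod : 0 < modDelta L e dV hdV dW hdW p := modDelta_pos L e dV hdV dW hdW p
  have hxc : Φ (x * c) = modDelta L e dV hdV dW hdW p * Φ (k * c) := apply_mul_eq_of_decomp L e dV hdV dW hdW hΦ hp hx c
  have hxk : Φ x = modDelta L e dV hdV dW hdW p * Φ k := by rw [hx, hΦ p k hp]
  constructor
  · -- `Φ(k c) ≤ A Φ(k)`
    have h := exists_ratio_bound hc₀ hlow₀ hup₁ k hk (k * c) hkc
    rw [hxc, hxk, ← mul_assoc, mul_comm (max _ _) (modDelta _ _ _ _ _ _ p), mul_assoc]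
    exact mul_le_mul_of_nonneg_left (h.trans (mul_le_mul_of_nonneg_right (le_max_left _ _) (hΦpos k).le)) hmod.le
  · -- `Φ(k) ≤ A Φ(k c)`
    have h := exists_ratio_bound hc₁ hlow₁ hup₀ (k * c) hkc k hk
    rw [hxc, hxk, ← mul_assoc, mul_comm (max _ _) (modDelta _ _ _ _ _ _ p), mul_assoc]
    exact mul_le_mul_of_nonneg_left (h.trans (mul_le_mul_of_nonneg_right (le_max_right _ _) (hΦpos (k * c)).le)) hmod.le

omit [NumberField L] [IsCMField L] in
/-- Powers: `Φ(x) ≤ A Φ(y)` with `Φ > 0`, `A ≥ 0`, `τ ≥ 0` gives `Φ(x)^τ ≤ A^τ Φ(y)^τ`. [folklore] -/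
theorem rpow_le_mul_rpow_of_le {a b A τ : ℝ} (ha : 0 ≤ a) (hA : 0 ≤ A) (hτ : 0 ≤ τ) (h : a ≤ A * b) (hb : 0 ≤ b) :
    a ^ τ ≤ A ^ τ * b ^ τ := by
  rw [← Real.mul_rpow hA hb]
  exact Real.rpow_le_rpow ha h hτ

/-- **SMEAR for powers**: under the hypotheses of `exists_smear_const`, for `τ ≥ 0` and compact `C` there is `B ≥ 1` with
`Φ(x)^τ ≤ B · Φ(x c)^τ` and `Φ(x c)^τ ≤ B · Φ(x)^τ` for all `x`, all `c ∈ C` — the series `Σ_γ Φ(γ h)^τ` is dominated by (and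
dominates) its average over `h C`. [cite: Garrett2018, §3.10 (proof of Cor. 3.10.2)] -/
theorem exists_smear_const_rpow {K₀ : Set (HA L e dV hdV dW hdW)} (hK₀ : IsCompact K₀)
    (hPK : ∀ x : HA L e dV hdV dW hdW, ∃ p k : HA L e dV hdV dW hdW, IsSiegelDelta L e dV hdV dW hdW p ∧ k ∈ K₀ ∧ x = p * k)
    {Φ : HA L e dV hdV dW hdW → ℝ} (hΦpos : ∀ x, 0 < Φ x)
    (hΦ : ∀ p x : HA L e dV hdV dW hdW, IsSiegelDelta L e dV hdV dW hdW p → Φ (p * x) = modDelta L e dV hdV dW hdW p * Φ x)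
    (hΦlow : ∀ K : Set (HA L e dV hdV dW hdW), IsCompact K → ∃ c : ℝ, 0 < c ∧ ∀ k ∈ K, c ≤ Φ k)
    (hΦup : ∀ K : Set (HA L e dV hdV dW hdW), IsCompact K → ∃ C : ℝ, ∀ k ∈ K, Φ k ≤ C)
    {C : Set (HA L e dV hdV dW hdW)} (hC : IsCompact C) {τ : ℝ} (hτ : 0 ≤ τ) :
    ∃ B : ℝ, 1 ≤ B ∧ ∀ x : HA L e dV hdV dW hdW, ∀ c ∈ C,
      Φ x ^ τ ≤ B * Φ (x * c) ^ τ ∧ Φ (x * c) ^ τ ≤ B * Φ x ^ τ := by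
  obtain ⟨A, hA1, hA⟩ := exists_smear_const L e dV hdV dW hdW hK₀ hPK hΦpos hΦ hΦlow hΦup hC
  have hA0 : 0 ≤ A := le_trans zero_le_one hA1
  refine ⟨A ^ τ, Real.one_le_rpow hA1 hτ, fun x c hc => ⟨?_, ?_⟩⟩
  · exact rpow_le_mul_rpow_of_le (hΦpos x).le hA0 hτ (hA x c hc).2 (hΦpos _).le
  · exact rpow_le_mul_rpow_of_le (hΦpos _).le hA0 hτ (hA x c hc).1 (hΦpos x).le

/-- The upper bound on compacta of a height follows from Godement's FLOOR at `γ = 1` (the shape delivered by ★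
`K2LiuSiegelDoubledPluckerHeight.exists_siegelHeight` (4)). [cite: Garrett2018, §3.10] -/
theorem upper_bound_of_floor {Φ : HA L e dV hdV dW hdW → ℝ}
    (hfloor : ∀ K : Set (HA L e dV hdV dW hdW), IsCompact K → ∃ C : ℝ, ∀ k ∈ K, ∀ γ : ratH L e dV hdV dW hdW,
      Φ ((γ : HA L e dV hdV dW hdW) * k) ≤ C) :
    ∀ K : Set (HA L e dV hdV dW hdW), IsCompact K → ∃ C : ℝ, ∀ k ∈ K, Φ k ≤ C := by
  intro K hK
  obtain ⟨C, hC⟩ := hfloor K hK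
  refine ⟨C, fun k hk => ?_⟩
  have h := hC k hk 1
  rwa [Subgroup.coe_one, one_mul] at h

end Summit.HodgeConjecture.HodgeConjecture.Cruxes.HLiu418.K2LiuSiegelDoubledHeightSmear

end
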